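import Literature.Analysis.FluidPDE.EyinkUniformDefectOfEuler
import Literature.Analysis.FunctionSpaces.TorusSpaceTimeKernel
import Literature.Analysis.FunctionSpaces.BesovDifference
import HarnessLib

/-!
# The local energy flux against mollified test functions: glue

Analysis/FluidPDE support file (theorem-only; serves the discharge of De Rosa–Isett's Eulerian
intermittency theorem, `Literature.Barriers.AnomalousDissipation.DeRosaIsett2024_thm27`, whose
proof tests the local energy balance of a weak Euler solution against slice-wise mollified and
cut-off test functions). For the local energy flux functional
`D(v,p)(ψ) = ∫₀ᵀ∫ ½|v|²∂ₜψ + (½|v|² + p)⟪v,∇ψ⟫` (`Torus.energyFluxFunctional`,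
`EyinkUniformDefectOfEuler`) of `v ∈ L³((0,T) × T^d)`, `p ∈ L^{3/2}((0,T) × T^d)` and the torus
mollifier `k_ε = Torus.kernel ε` (`TorusMollifier`):

* `Torus.isSpaceTimeTestIoo_kernel_conv`, `Torus.timeDeriv_kernel_conv` — the slice-wise
  mollification `t ↦ k ⋆ φ(t)` of a test function supported in `(0,T)` is again one, with
  `∂ₜ(k ⋆ φ) = k ⋆ ∂ₜφ` (the tree's `IsSmoothSpaceTimeOn.convolution`,
  `timeDerivWithin_convolution_Icc`; `∇(k ⋆ φ(t)) = k ⋆ ∇φ(t)` is `Torus.gradient_convolution`);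
* `Torus.exists_forall_dist_lt_of_continuous_uncurry`, `Torus.dist_kernel_conv_le` — uniform
  continuity of jointly continuous data on `[0,T] × T^d` and the resulting uniform approximation
  `‖k_ε ⋆ g - g‖_∞ ≤ η` (Mathlib's `dist_convolution_le`; Evans, App. C.4, Thm. 7 (iii));
* `Torus.abs_energyFluxFunctional_sub_le` — `D(v,p)` is Lipschitz in the sup norms of the test
  data `(∂ₜψ, ∇ψ)` on `[0,T] × T^d`, with constant `∫∫ ½|v|² + (½|v|² + |p|)|v|`
  (`Torus.integrable_normSq_normCube_norm_mul`, Hölder `3/2, 3`);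
* `lintegral_lintegral_enorm_rpow_lt_top_of_memLpBesovSup`,
  `Torus.lintegral_pow_three_lt_top_of_memLpBesovSup` — `L^q_t B^θ_{q,∞} ⊂ L^q_{t,x} ⊂ L³_{t,x}`
  on `(0,T) × T^d` for `q ∈ [3, ∞)` (the integrability class of the tree's Duchon–Robert
  identities).

## References

* L. C. Evans, *Partial Differential Equations*, 2nd ed. (2010), App. C.4, Thm. 7. [Evans2010]
* L. De Rosa, P. Isett, Arch. Ration. Mech. Anal. 248 (2024), Paper No. 11 = arXiv:2212.08176,
  §5.1 (where these facts are used). [DeRosaIsett2024]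
-/

open MeasureTheory Set Filter Metric Function
open _root_.Topology
open scoped ENNReal NNReal Convolution InnerProductSpace RealInnerProductSpace

noncomputable section

namespace Literature.Analysis.FluidPDE.Torus

variable {d : Type*} [Fintype d]


/-! ## `L^q_t B^s_{q,∞} ⊂ L^q_{t,x} ⊂ L³_{t,x}` -/

section Lebesgue

variable {G F' : Type*} [NormedAddCommGroup G] [MeasurableSpace G] [NormedAddCommGroup F']

omit [Fintype d] in
/-- **`L^q_t B^{s}_{q,∞} ⊂ L^q_{t,x}`.** A field of class `MemLpBesovSup q s q` on the time set `S`,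
`0 < q < ∞`, has `∫_S ∫ ‖u‖^q < ∞`: slice-wise `‖u(t)‖_{L^q} ≤ ‖u(t)‖_{B^s_{q,∞}}`, raised to the
power `q` and integrated in time against the finiteness of `eLpBesovSupNorm` (the tree's
`lintegral_lintegral_enorm_pow_three_lt_top_of_memLpBesovSup` is the case `q = 3`). [folklore] -/
theorem lintegral_lintegral_enorm_rpow_lt_top_of_memLpBesovSup {q : ℝ≥0∞} (hq0 : q ≠ 0)
    (hq' : q ≠ ∞) {μ : Measure G} {s : ℝ} {S : Set ℝ} {u : ℝ → G → F'}
    (hB : FunctionSpaces.MemLpBesovSup q s q u μ S) :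
    ∫⁻ t in S, ∫⁻ x, ‖u t x‖ₑ ^ q.toReal ∂μ < ⊤ := by
  have hqpos : 0 < q.toReal := ENNReal.toReal_pos hq0 hq'
  have h2 : ∫⁻ t in S, ‖(FunctionSpaces.eBesovSupNorm s q (u t) μ).toReal‖ₑ ^ q.toReal < ⊤ :=
    lintegral_rpow_enorm_lt_top_of_eLpNorm_lt_top hq0 hq' hB.2
  refine lt_of_le_of_lt (lintegral_mono_ae ?_) h2
  filter_upwards [hB.1] with t ht
  have hfin : FunctionSpaces.eBesovSupNorm s q (u t) μ ≠ ⊤ := ht.eBesovSupNorm_lt_top.ne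
  have hpow : ∫⁻ x, ‖u t x‖ₑ ^ q.toReal ∂μ = eLpNorm (u t) q μ ^ q.toReal := by
    rw [eLpNorm_eq_eLpNorm' hq0 hq', ← lintegral_rpow_enorm_eq_rpow_eLpNorm' hqpos]
  rw [hpow, Real.enorm_eq_ofReal ENNReal.toReal_nonneg, ENNReal.ofReal_toReal hfin]
  exact ENNReal.rpow_le_rpow le_self_add hqpos.le

/-- **`L^q_{t,x} ⊂ L³_{t,x}` on `(0,T) × T^d`, `q ≥ 3`** (the strip has finite measure; Mathlib's
`eLpNorm_le_eLpNorm_mul_rpow_measure_univ` on the product measure, and Tonelli). [folklore] -/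
theorem lintegral_pow_three_lt_top_of_lintegral_rpow {q : ℝ≥0∞} (hq : 3 ≤ q) (hq' : q ≠ ∞)
    {T : ℝ} {u : ℝ → UnitAddTorus d → F'}
    (hm : AEStronglyMeasurable (uncurry u) ((volume.restrict (Ioo 0 T)).prod volume))
    (h : ∫⁻ t in Ioo 0 T, ∫⁻ x, ‖u t x‖ₑ ^ q.toReal < ⊤) :
    ∫⁻ t in Ioo 0 T, ∫⁻ x, ‖u t x‖ₑ ^ (3 : ℕ) < ⊤ := by
  set μT := (volume.restrict (Ioo 0 T)).prod (volume : Measure (UnitAddTorus d)) with hμT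
  have hq0 : q ≠ 0 := (lt_of_lt_of_le (by norm_num) hq).ne'
  have eq : ∫⁻ t in Ioo 0 T, ∫⁻ x, ‖u t x‖ₑ ^ q.toReal = ∫⁻ z, ‖u z.1 z.2‖ₑ ^ q.toReal ∂μT :=
    lintegral_Ioo_lintegral_eq_lintegral_prod (hm.enorm.pow_const _)
  have e3 : ∫⁻ t in Ioo 0 T, ∫⁻ x, ‖u t x‖ₑ ^ (3 : ℕ) = ∫⁻ z, ‖u z.1 z.2‖ₑ ^ (3 : ℕ) ∂μT :=
    lintegral_Ioo_lintegral_eq_lintegral_prod (hm.enorm.pow_const _)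
  rw [eq] at h
  rw [e3]
  have hLq : eLpNorm (uncurry u) q μT < ⊤ := by
    rw [eLpNorm_lt_top_iff_lintegral_rpow_enorm_lt_top (μ := μT) hq0 hq']
    simpa only [Function.uncurry] using h
  have hL3 : eLpNorm (uncurry u) 3 μT < ⊤ := by
    refine lt_of_le_of_lt (eLpNorm_le_eLpNorm_mul_rpow_measure_univ hq hm) ?_
    refine ENNReal.mul_lt_top hLq (ENNReal.rpow_lt_top_of_nonneg ?_ (measure_ne_top _ _))
    rw [sub_nonneg, ENNReal.toReal_ofNat]
    have h3 : (3 : ℝ) ≤ q.toReal := by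
      have := (ENNReal.toReal_le_toReal (by norm_num) hq').2 hq
      simpa using this
    exact one_div_le_one_div_of_le (by norm_num) h3
  have h := (eLpNorm_lt_top_iff_lintegral_rpow_enorm_lt_top (μ := μT) three_ne_zero
    ENNReal.ofNat_ne_top).1 hL3
  have h3 : ∀ x : ℝ≥0∞, x ^ (3 : ℝ≥0∞).toReal = x ^ (3 : ℕ) := fun x => by
    rw [ENNReal.toReal_ofNat, ← ENNReal.rpow_natCast]; norm_num
  simpa only [h3, Function.uncurry] using h

/-- **`L^q_t B^θ_{q,∞} ⊂ L³_{t,x}` on `(0,T) × T^d` for `q ∈ [3,∞)`** (the integrability class in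
which the tree's Duchon–Robert identities are stated). [folklore] -/
theorem lintegral_pow_three_lt_top_of_memLpBesovSup {q : ℝ≥0∞} (hq : 3 ≤ q) (hq' : q ≠ ∞)
    {T θ : ℝ} {u : ℝ → UnitAddTorus d → F'}
    (hm : AEStronglyMeasurable (uncurry u) ((volume.restrict (Ioo 0 T)).prod volume))
    (hB : FunctionSpaces.MemLpBesovSup q θ q u volume (Ioo 0 T)) :
    ∫⁻ t in Ioo 0 T, ∫⁻ x, ‖u t x‖ₑ ^ (3 : ℕ) < ⊤ :=
  lintegral_pow_three_lt_top_of_lintegral_rpow hq hq' hm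
    (lintegral_lintegral_enorm_rpow_lt_top_of_memLpBesovSup (lt_of_lt_of_le (by norm_num) hq).ne'
      hq' hB)

end Lebesgue

/-! ## Slice-wise mollification of test functions -/

section MollifiedTest

variable {T : ℝ} {φ : ℝ → UnitAddTorus d → ℝ} {k : UnitAddTorus d → ℝ}

omit [Fintype d] in
/-- For real functions the two mollification conventions agree slice-wise:
`φ(t) ⋆ k = k ⋆ φ(t)` (`FunctionSpaces.Torus.convolution_comm_real`). [folklore] -/
theorem conv_kernel_comm [Fintype d] (k : UnitAddTorus d → ℝ) (φ : ℝ → UnitAddTorus d → ℝ) :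
    (fun t => φ t ⋆ k) = fun t => k ⋆ φ t :=
  funext fun _ => FunctionSpaces.Torus.convolution_comm_real _ _

/-- **The slice-wise mollification of a test function supported in `(0,T)` is again such a test
function** (jointly smooth by the tree's `IsSmoothSpaceTimeOn.convolution`; the time support is
inherited since `k ⋆ 0 = 0`). [folklore] -/
theorem isSpaceTimeTestIoo_kernel_conv (hφ : FunctionSpaces.Torus.IsSpaceTimeTestIoo T φ)
    (hk : Integrable k volume) : FunctionSpaces.Torus.IsSpaceTimeTestIoo T (fun t => k ⋆ φ t) := by
  obtain ⟨⟨hs, T', hT', h0⟩, ε₀, hε₀, h1⟩ := hφ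
  have hsm : FunctionSpaces.Torus.IsSmoothSpaceTimeOn univ φ := hs.contDiffOn
  have hconv : FunctionSpaces.Torus.IsSmoothSpaceTimeOn univ (fun t => k ⋆ φ t) :=
    hsm.convolution hk convex_univ (by simp)
  refine ⟨⟨?_, T', hT', fun t ht => ?_⟩, ε₀, hε₀, fun t ht => ?_⟩
  · rw [← contDiffOn_univ, ← univ_prod_univ]
    exact hconv
  · show k ⋆ φ t = 0
    rw [h0 t ht]
    exact convolution_zero
  · show k ⋆ φ t = 0
    rw [h1 t ht]
    exact convolution_zero

/-- **`∂ₜ(φ ⋆ₓ k) = (∂ₜφ) ⋆ₓ k`** for a space–time test function `φ` and `k ∈ L¹(T^d)` (the tree's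
one-sided `FunctionSpaces.Torus.timeDerivWithin_convolution_Icc` on `[t-1, t+1]`, in whose interior the one- and
two-sided time derivatives agree). [folklore] -/
theorem timeDeriv_kernel_conv (hφ : FunctionSpaces.Torus.IsSpaceTimeTest T φ) (hk : Integrable k volume)
    (t : ℝ) (x : UnitAddTorus d) :
    FunctionSpaces.Torus.timeDeriv (fun t => k ⋆ φ t) t x = (k ⋆ FunctionSpaces.Torus.timeDeriv φ t) x := by
  have hab : t - 1 < t + 1 := by linarith
  have ht : t ∈ Icc (t - 1) (t + 1) := ⟨by linarith, by linarith⟩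
  have hti : t ∈ interior (Icc (t - 1) (t + 1)) := by
    rw [interior_Icc]; exact ⟨by linarith, by linarith⟩
  have h := FunctionSpaces.Torus.timeDerivWithin_convolution_Icc hk hab (hφ.isSmoothSpaceTimeOn _) ht x
  rw [FunctionSpaces.Torus.timeDerivWithin_of_mem_interior hti] at h
  rw [h]
  congr 1
  funext y
  exact FunctionSpaces.Torus.timeDerivWithin_of_mem_interior hti y

end MollifiedTest

/-! ## Uniform continuity of the test data and uniform convergence of slice mollifications -/

section Uniform

/-- A jointly continuous field on `ℝ × T^d` is uniformly continuous in `x`, uniformly for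
`t ∈ [0, T]` (Heine–Cantor on the compact `[0,T] × T^d`). [folklore] -/
theorem exists_forall_dist_lt_of_continuous_uncurry {G' : Type*} [PseudoMetricSpace G']
    {g : ℝ → UnitAddTorus d → G'} (hg : Continuous (uncurry g)) (T : ℝ) {η : ℝ} (hη : 0 < η) :
    ∃ δ > 0, ∀ t ∈ Icc 0 T, ∀ x y : UnitAddTorus d, dist x y < δ → dist (g t x) (g t y) < η := by
  have hK : IsCompact (Icc 0 T ×ˢ (univ : Set (UnitAddTorus d))) := isCompact_Icc.prod isCompact_univ
  have hU := hK.uniformContinuousOn_of_continuous hg.continuousOn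
  obtain ⟨δ, hδ, h⟩ := Metric.uniformContinuousOn_iff.1 hU η hη
  refine ⟨δ, hδ, fun t ht x y hxy => ?_⟩
  have h' := h (t, x) ⟨ht, mem_univ _⟩ (t, y) ⟨ht, mem_univ _⟩
  rw [Prod.dist_eq, dist_self, max_eq_right dist_nonneg] at h'
  exact h' hxy

/-- **Uniform approximation by the torus mollifier under a modulus of continuity**: if
`dist (g x) (g y) ≤ η` whenever `dist x y < δ`, then `‖(k_ε ⋆ g)(x) - g(x)‖ ≤ η` for
`0 < ε ≤ min δ (1/4)` (Mathlib's `dist_convolution_le`: `k_ε ≥ 0` has unit mass and support in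
`B(0, ε)`; Evans, App. C.4, Thm. 7 (iii)). [folklore] -/
theorem dist_kernel_conv_le {G' : Type*} [NormedAddCommGroup G'] [NormedSpace ℝ G'] [CompleteSpace G']
    {g : UnitAddTorus d → G'} (hgm : AEStronglyMeasurable g volume) {η δ ε : ℝ} (hη : 0 ≤ η)
    (hmod : ∀ x y : UnitAddTorus d, dist x y < δ → dist (g x) (g y) ≤ η) (hε : 0 < ε)
    (hεδ : ε ≤ δ) (hε4 : ε ≤ 1 / 4) (x₀ : UnitAddTorus d) :
    dist ((FunctionSpaces.Torus.kernel ε ⋆ g) x₀) (g x₀) ≤ η :=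
  dist_convolution_le hη (FunctionSpaces.Torus.support_kernel_subset hε) (FunctionSpaces.Torus.kernel_nonneg hε.le)
    (FunctionSpaces.Torus.integral_kernel hε hε4) hgm fun x hx => hmod x x₀ ((mem_ball.1 hx).trans_le hεδ)

end Uniform

/-! ## The local energy flux is Lipschitz in the test data -/

section Flux

variable {T : ℝ} {v : ℝ → UnitAddTorus d → EuclideanSpace ℝ d} {p : ℝ → UnitAddTorus d → ℝ}

/-- **Basic integrability on the strip**: for jointly measurable `v ∈ L³`, `p ∈ L^{3/2}` on
`(0,T) × T^d`, the functions `|v|²`, `|v|³` and `|p||v|` are integrable for the product measure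
(Hölder `3/2, 3`; the bookkeeping of the tree's `Torus.integrable_flux_pieces`). [folklore] -/
theorem integrable_normSq_normCube_norm_mul
    (hv : AEStronglyMeasurable (uncurry v) ((volume.restrict (Ioo 0 T)).prod volume))
    (hv3 : ∫⁻ t in Ioo 0 T, ∫⁻ x, ‖v t x‖ₑ ^ (3 : ℕ) < ⊤)
    (hq : AEStronglyMeasurable (uncurry p) ((volume.restrict (Ioo 0 T)).prod volume))
    (hq32 : ∫⁻ t in Ioo 0 T, ∫⁻ x, ‖p t x‖ₑ ^ (3 / 2 : ℝ) < ⊤) :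
    Integrable (fun z : ℝ × UnitAddTorus d => ‖v z.1 z.2‖ ^ 2)
        ((volume.restrict (Ioo 0 T)).prod volume) ∧
      Integrable (fun z : ℝ × UnitAddTorus d => ‖v z.1 z.2‖ ^ 3)
        ((volume.restrict (Ioo 0 T)).prod volume) ∧
      Integrable (fun z : ℝ × UnitAddTorus d => ‖p z.1 z.2‖ * ‖v z.1 z.2‖)
        ((volume.restrict (Ioo 0 T)).prod volume) := by
  set μT := (volume.restrict (Ioo 0 T)).prod (volume : Measure (UnitAddTorus d)) with hμT
  have e3 : ∫⁻ t in Ioo 0 T, ∫⁻ x, ‖v t x‖ₑ ^ (3 : ℕ) = ∫⁻ z, ‖v z.1 z.2‖ₑ ^ (3 : ℕ) ∂μT :=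
    lintegral_Ioo_lintegral_eq_lintegral_prod (hv.enorm.pow_const _)
  have e32 : ∫⁻ t in Ioo 0 T, ∫⁻ x, ‖p t x‖ₑ ^ (3 / 2 : ℝ) = ∫⁻ z, ‖p z.1 z.2‖ₑ ^ (3 / 2 : ℝ) ∂μT :=
    lintegral_Ioo_lintegral_eq_lintegral_prod (hq.enorm.pow_const _)
  rw [e3] at hv3
  rw [e32] at hq32
  have hM3 : MemLp (uncurry v) 3 μT := by
    refine ⟨hv, (eLpNorm_lt_top_iff_lintegral_rpow_enorm_lt_top three_ne_zero
      ENNReal.ofNat_ne_top).2 ?_⟩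
    have h3 : ∀ x : ℝ≥0∞, x ^ (3 : ℝ≥0∞).toReal = x ^ (3 : ℕ) := fun x => by
      rw [ENNReal.toReal_ofNat, ← ENNReal.rpow_natCast]; norm_num
    simpa only [h3, Function.uncurry] using hv3
  have I2 : Integrable (fun z => ‖v z.1 z.2‖ ^ 2) μT :=
    (memLp_two_iff_integrable_sq_norm hv).1 (hM3.mono_exponent (by norm_num))
  have I3 : Integrable (fun z => ‖v z.1 z.2‖ ^ 3) μT := by
    have h := hM3.integrable_norm_rpow three_ne_zero ENNReal.ofNat_ne_top
    refine h.congr (Eventually.of_forall fun z => ?_)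
    simp only [ENNReal.toReal_ofNat, uncurry]
    norm_cast
  have Iqv : Integrable (fun z => ‖p z.1 z.2‖ * ‖v z.1 z.2‖) μT := by
    refine ⟨(hq.norm.mul hv.norm), ?_⟩
    have hH : Real.HolderConjugate (3 / 2 : ℝ) 3 := ⟨by norm_num, by norm_num, by norm_num⟩
    have h := ENNReal.lintegral_mul_le_Lp_mul_Lq μT hH
      (f := fun z => ‖p z.1 z.2‖ₑ) (g := fun z => ‖v z.1 z.2‖ₑ) hq.enorm hv.enorm
    have h3 : ∀ x : ℝ≥0∞, x ^ (3 : ℝ) = x ^ (3 : ℕ) := fun x => by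
      rw [← ENNReal.rpow_natCast]; norm_num
    simp only [Pi.mul_apply, h3] at h
    refine lt_of_le_of_lt (lintegral_mono fun z => ?_) (lt_of_le_of_lt h ?_)
    · rw [enorm_mul, enorm_norm, enorm_norm]
    · exact ENNReal.mul_lt_top (ENNReal.rpow_lt_top_of_nonneg (by norm_num) hq32.ne)
        (ENNReal.rpow_lt_top_of_nonneg (by norm_num) hv3.ne)
  exact ⟨I2, I3, Iqv⟩

/-- **The local energy flux is Lipschitz in the test data**: if `|∂ₜψ₁ - ∂ₜψ₂| ≤ η` and
`‖∇ψ₁ - ∇ψ₂‖ ≤ η` on `[0,T] × T^d`, then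
`|𝓔(ψ₁) - 𝓔(ψ₂)| ≤ η ∫∫ (½|v|² + (½|v|² + |p|)|v|)`. [folklore] -/
theorem abs_energyFluxFunctional_sub_le [DecidableEq d]
    (hv : AEStronglyMeasurable (uncurry v) ((volume.restrict (Ioo 0 T)).prod volume))
    (hv3 : ∫⁻ t in Ioo 0 T, ∫⁻ x, ‖v t x‖ₑ ^ (3 : ℕ) < ⊤)
    (hq : AEStronglyMeasurable (uncurry p) ((volume.restrict (Ioo 0 T)).prod volume))
    (hq32 : ∫⁻ t in Ioo 0 T, ∫⁻ x, ‖p t x‖ₑ ^ (3 / 2 : ℝ) < ⊤)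
    {ψ₁ ψ₂ : ℝ → UnitAddTorus d → ℝ} (hψ₁ : FunctionSpaces.Torus.IsSpaceTimeTest T ψ₁)
    (hψ₂ : FunctionSpaces.Torus.IsSpaceTimeTest T ψ₂) {η : ℝ}
    (hdt : ∀ t ∈ Icc 0 T, ∀ x, |FunctionSpaces.Torus.timeDeriv ψ₁ t x - FunctionSpaces.Torus.timeDeriv ψ₂ t x| ≤ η)
    (hgr : ∀ t ∈ Icc 0 T, ∀ x, ‖FunctionSpaces.Torus.gradient (ψ₁ t) x - FunctionSpaces.Torus.gradient (ψ₂ t) x‖ ≤ η) :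
    |energyFluxFunctional T v p ψ₁ - energyFluxFunctional T v p ψ₂| ≤
      η * ∫ z, (2⁻¹ * ‖v z.1 z.2‖ ^ 2 + (2⁻¹ * ‖v z.1 z.2‖ ^ 2 + ‖p z.1 z.2‖) * ‖v z.1 z.2‖)
        ∂((volume.restrict (Ioo 0 T)).prod volume) := by
  set μT := (volume.restrict (Ioo 0 T)).prod (volume : Measure (UnitAddTorus d)) with hμT
  obtain ⟨I2, I3, Iqv⟩ := integrable_normSq_normCube_norm_mul hv hv3 hq hq32
  obtain ⟨hI1, e1⟩ := energyFluxFunctional_eq_integral_prod (T := T) hv hv3 hq hq32 hψ₁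
  obtain ⟨hI2, e2⟩ := energyFluxFunctional_eq_integral_prod (T := T) hv hv3 hq hq32 hψ₂
  rw [energyFluxFunctional_apply, energyFluxFunctional_apply, e1, e2, ← integral_sub hI1 hI2,
    ← integral_const_mul]
  have hIoo : ∀ᵐ z ∂μT, z.1 ∈ Ioo 0 T := by
    rw [hμT, ← volume_restrict_Ioo_prod_univ]
    filter_upwards [ae_restrict_mem (measurableSet_Ioo.prod MeasurableSet.univ)] with z hz
    exact hz.1
  have hB : Integrable (fun z : ℝ × UnitAddTorus d =>
      η * (2⁻¹ * ‖v z.1 z.2‖ ^ 2 + (2⁻¹ * ‖v z.1 z.2‖ ^ 2 + ‖p z.1 z.2‖) * ‖v z.1 z.2‖)) μT := by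
    refine Integrable.const_mul ?_ η
    have h : Integrable (fun z : ℝ × UnitAddTorus d =>
        2⁻¹ * ‖v z.1 z.2‖ ^ 2 + (2⁻¹ * ‖v z.1 z.2‖ ^ 3 + ‖p z.1 z.2‖ * ‖v z.1 z.2‖)) μT :=
      (I2.const_mul _).add ((I3.const_mul _).add Iqv)
    refine h.congr (Eventually.of_forall fun z => ?_)
    ring
  refine (abs_integral_le_integral_abs).trans (integral_mono_ae (hI1.sub hI2).abs hB ?_)
  · filter_upwards [hIoo] with z hz
    have ht : z.1 ∈ Icc 0 T := Ioo_subset_Icc_self hz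
    have h1 := hdt z.1 ht z.2
    have h2 := hgr z.1 ht z.2
    have e : 2⁻¹ * ‖v z.1 z.2‖ ^ 2 * FunctionSpaces.Torus.timeDeriv ψ₁ z.1 z.2 +
          (2⁻¹ * ‖v z.1 z.2‖ ^ 2 + p z.1 z.2) * ⟪v z.1 z.2, FunctionSpaces.Torus.gradient (ψ₁ z.1) z.2⟫ -
        (2⁻¹ * ‖v z.1 z.2‖ ^ 2 * FunctionSpaces.Torus.timeDeriv ψ₂ z.1 z.2 +
          (2⁻¹ * ‖v z.1 z.2‖ ^ 2 + p z.1 z.2) * ⟪v z.1 z.2, FunctionSpaces.Torus.gradient (ψ₂ z.1) z.2⟫) =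
        2⁻¹ * ‖v z.1 z.2‖ ^ 2 * (FunctionSpaces.Torus.timeDeriv ψ₁ z.1 z.2 - FunctionSpaces.Torus.timeDeriv ψ₂ z.1 z.2) +
          (2⁻¹ * ‖v z.1 z.2‖ ^ 2 + p z.1 z.2) *
            ⟪v z.1 z.2, FunctionSpaces.Torus.gradient (ψ₁ z.1) z.2 - FunctionSpaces.Torus.gradient (ψ₂ z.1) z.2⟫ := by
      rw [inner_sub_right]; ring
    rw [e]
    have hv0 : 0 ≤ ‖v z.1 z.2‖ := norm_nonneg _
    have hA : |2⁻¹ * ‖v z.1 z.2‖ ^ 2 * (FunctionSpaces.Torus.timeDeriv ψ₁ z.1 z.2 - FunctionSpaces.Torus.timeDeriv ψ₂ z.1 z.2)| ≤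
        2⁻¹ * ‖v z.1 z.2‖ ^ 2 * η := by
      rw [abs_mul, abs_of_nonneg (by positivity)]
      exact mul_le_mul_of_nonneg_left h1 (by positivity)
    have hBd : |(2⁻¹ * ‖v z.1 z.2‖ ^ 2 + p z.1 z.2) *
          ⟪v z.1 z.2, FunctionSpaces.Torus.gradient (ψ₁ z.1) z.2 - FunctionSpaces.Torus.gradient (ψ₂ z.1) z.2⟫| ≤
        (2⁻¹ * ‖v z.1 z.2‖ ^ 2 + ‖p z.1 z.2‖) * (‖v z.1 z.2‖ * η) := by
      rw [abs_mul]
      refine mul_le_mul ?_ ?_ (abs_nonneg _) (by positivity)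
      · calc |2⁻¹ * ‖v z.1 z.2‖ ^ 2 + p z.1 z.2| ≤ |2⁻¹ * ‖v z.1 z.2‖ ^ 2| + |p z.1 z.2| :=
              abs_add_le _ _
          _ = 2⁻¹ * ‖v z.1 z.2‖ ^ 2 + ‖p z.1 z.2‖ := by
              rw [abs_of_nonneg (by positivity), Real.norm_eq_abs]
      · calc |⟪v z.1 z.2, FunctionSpaces.Torus.gradient (ψ₁ z.1) z.2 - FunctionSpaces.Torus.gradient (ψ₂ z.1) z.2⟫|
            ≤ ‖v z.1 z.2‖ * ‖FunctionSpaces.Torus.gradient (ψ₁ z.1) z.2 - FunctionSpaces.Torus.gradient (ψ₂ z.1) z.2‖ :=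
              abs_real_inner_le_norm _ _
          _ ≤ ‖v z.1 z.2‖ * η := mul_le_mul_of_nonneg_left h2 hv0
    calc _ ≤ |2⁻¹ * ‖v z.1 z.2‖ ^ 2 * (FunctionSpaces.Torus.timeDeriv ψ₁ z.1 z.2 - FunctionSpaces.Torus.timeDeriv ψ₂ z.1 z.2)| +
          |(2⁻¹ * ‖v z.1 z.2‖ ^ 2 + p z.1 z.2) *
            ⟪v z.1 z.2, FunctionSpaces.Torus.gradient (ψ₁ z.1) z.2 - FunctionSpaces.Torus.gradient (ψ₂ z.1) z.2⟫| :=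
          abs_add_le _ _
      _ ≤ 2⁻¹ * ‖v z.1 z.2‖ ^ 2 * η + (2⁻¹ * ‖v z.1 z.2‖ ^ 2 + ‖p z.1 z.2‖) * (‖v z.1 z.2‖ * η) :=
          add_le_add hA hBd
      _ = η * (2⁻¹ * ‖v z.1 z.2‖ ^ 2 + (2⁻¹ * ‖v z.1 z.2‖ ^ 2 + ‖p z.1 z.2‖) * ‖v z.1 z.2‖) := by
          ring

end Flux


end Literature.Analysis.FluidPDE.Torus

end
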